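import Mathlib
import Summits.NavierStokesRegularity.NavierStokesRegularity.Theorems.WakeRatchetTailRatchet.Negative.TailRatchetFalseOfDyadicScalarFronts
import Summits.NavierStokesRegularity.NavierStokesRegularity.Theorems.WakeRatchetTailRatchetStall
import HarnessLib

/-!
# `WakeRatchet.TailRatchet` (stmt-NavierStokesRegularity-21808), door D4′ — the SCALAR ENDGAME:
# a scalar admissible eternal solution of the renormalised dyadic lattice with persistent firing refutes the crux

Def-free adapter file.  MODEL lattice ODEs only (the scalar dyadic member of Tao 2016 §1.2 / §4 in the
renormalised variables of §6.4); nothing in this file is a statement about the Navier–Stokes equations;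
stmt-21808 is neither proved nor refuted here and no stub of skeleton d00b85951d7c is closed.

WHY.  Door D4′ (census of stmt-21808) ends with the kill criterion
`WakeRatchetStall.tailRatchet_false_of_persistentFiring`, which wants an `Em 4`-valued admissible eternal
solution `IsEternalVisc ε₀ νh α W` of an E₂(R) table with `UniformBound` and persistent firing.  Everything
on the Cauchy side of the door (type-I rates, positivity, local/maximal existence, uniqueness, blow-up, the
scalar front theory) is SCALAR: one real amplitude per shell, the `e₀`-component of the dyadic member.  This
file supplies the adapter once and for all:

* `tableQ_smul_single`, `tableA_smul_single`, `tableB_smul_single` — the structure maps of `dyadicTable` on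
  the line `ℝ·e₀` (from the tree's `WakeRatchetDyadicFront.table*_dyadicTable`).
* `isEternal_dyadic_of_scalar` — a scalar family `w : ℤ → ℝ → ℝ` solving the renormalised dyadic lattice
  `wₙ' = −wₙ + Λ wₙ₋₁² − Λ⁻¹ wₙ wₙ₊₁` (`Λ = bigLam ε₀`) at every shell and log-time, with a uniform per-shell
  action bound and per-shell forward boundedness of `e^{2σ}wₙ²`, gives the admissible eternal solution
  `Wₙ(σ) = wₙ(σ)·e₀` of `dyadicTable`: `IsEternal ε₀ dyadicTable W`.
* `uniformBound_of_scalar` — `|wₙ| ≤ C ⇒ UniformBound W`.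
* `tailRatchet_false_of_scalarPersistentFiring` — THE SCALAR KILL CRITERION: at arbitrarily small `ε₀`, a
  scalar admissible eternal solution of the renormalised dyadic lattice, uniformly bounded, in which
  infinitely many forward shells `n₀ + j` reach a fixed level `c > 0` at log-times `≥ σ₀`, refutes
  `TailRatchet` (spread `R = 2`, the dyadic member `dyadicTable ∈ E₂(2)`, `ν̂ = 0`).

So the remaining analytic debt of door D4′ — quietness (Q) and the wake bound (D) for the one-shell dyadic
Cauchy blow-up, then the extraction — may be discharged entirely in scalar variables.

HONEST FRAMING: bookkeeping; the analytic inputs (Q), (D) and the extraction are NOT addressed; rung 0.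
-/

noncomputable section

set_option linter.dupNamespace false

namespace Summit.NavierStokesRegularity.NavierStokesRegularity.Theorems

namespace WakeRatchetDyadicScalarEternal

open Set Filter Topology MeasureTheory
open Literature.Analysis.FluidPDE Literature.Analysis.FluidPDE.TaoCascade
open WakeRatchetDyadicFront
open Summit.NavierStokesRegularity.NavierStokesRegularity.Theses.WakeRatchet

/-! ## The dyadic structure maps on the line `ℝ·e₀` -/

/-- `Q(w·e₀) = 0` for the dyadic table. [cite: Tao2016AveragedNS, §1.2, §4 (4.1); tree `tableQ_dyadicTable`] -/
theorem tableQ_smul_single (w : ℝ) :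
    tableQ dyadicTable (w • EuclideanSpace.single (0 : Fin 4) (1 : ℝ)) = 0 :=
  tableQ_dyadicTable _

/-- `A(w·e₀) = w²·e₀` for the dyadic table. [cite: Tao2016AveragedNS, §1.2, §4 (4.1); tree `tableA_dyadicTable`] -/
theorem tableA_smul_single (w : ℝ) :
    tableA dyadicTable (w • EuclideanSpace.single (0 : Fin 4) (1 : ℝ))
      = (w ^ 2) • EuclideanSpace.single (0 : Fin 4) (1 : ℝ) := by
  rw [tableA_dyadicTable]
  congr 1
  simp [sq]

/-- `B(y·e₀, x·e₀) = −(x y)·e₀` for the dyadic table. [cite: Tao2016AveragedNS, §1.2, §4 (4.1); tree `tableB_dyadicTable`] -/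
theorem tableB_smul_single (y x : ℝ) :
    tableB dyadicTable (y • EuclideanSpace.single (0 : Fin 4) (1 : ℝ))
        (x • EuclideanSpace.single (0 : Fin 4) (1 : ℝ))
      = (-(x * y)) • EuclideanSpace.single (0 : Fin 4) (1 : ℝ) := by
  rw [tableB_dyadicTable]
  congr 1
  simp

/-! ## Scalar admissible eternal solutions embed as `IsEternal ε₀ dyadicTable` -/

section Scalar

variable {ε₀ : ℝ} {w : ℤ → ℝ → ℝ}

/-- **Scalar ⇒ `IsEternal` for the dyadic member.**  A scalar family `w` solving the renormalised dyadic
lattice `wₙ' = −wₙ + Λwₙ₋₁² − Λ⁻¹wₙwₙ₊₁`, `Λ = bigLam ε₀`, at every shell and log-time, with a uniform per-shell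
action bound `∫|wₙ| ≤ M` and per-shell forward boundedness of `e^{2σ}wₙ(σ)²`, is — on the line `ℝ·e₀` — an
admissible eternal solution of `dyadicTable`.
[cite: Tao2016AveragedNS, §1.2 (dyadic model), §4 Lemma 4.1 (4.8) in the self-similar variables of §6.4; cell vocabulary (`IsEternal`)] -/
theorem isEternal_dyadic_of_scalar
    (hlaw : ∀ (n : ℤ) (σ : ℝ), HasDerivAt (w n)
      (-(w n σ) + bigLam ε₀ * w (n - 1) σ ^ 2 - (bigLam ε₀)⁻¹ * w n σ * w (n + 1) σ) σ)
    (haction : ∃ M : ℝ, ∀ n : ℤ, Integrable (fun σ => |w n σ|) ∧ ∫ σ, |w n σ| ≤ M)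
    (hbdd : ∀ n : ℤ, ∃ σ₀ P : ℝ, ∀ σ, σ₀ ≤ σ → Real.exp (2 * σ) * w n σ ^ 2 ≤ P) :
    IsEternal ε₀ dyadicTable
      (fun n σ => w n σ • EuclideanSpace.single (0 : Fin 4) (1 : ℝ)) := by
  -- `‖c·e₀‖ = |c|` (tree: `…SeparableTightness.norm_smul_single`)
  have norm_smul_single : ∀ c : ℝ, ‖(c • EuclideanSpace.single (0 : Fin 4) (1 : ℝ) : Em 4)‖ = |c| :=
    fun c => by rw [norm_smul, PiLp.norm_single, norm_one, mul_one, Real.norm_eq_abs]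
  set e₀ : Em 4 := EuclideanSpace.single (0 : Fin 4) (1 : ℝ) with he₀
  refine ⟨fun n σ => ?_, ?_, fun n => ?_⟩
  · -- the law on the line `ℝ·e₀`
    have h := (hlaw n σ).smul_const e₀
    refine h.congr_deriv ?_
    rw [tableQ_smul_single, tableA_smul_single, tableB_smul_single, add_zero, ← he₀]
    simp only [smul_smul]
    rw [← neg_smul, ← add_smul, ← add_smul]
    congr 1
    ring
  · -- the uniform per-shell action bound
    obtain ⟨M, hM⟩ := haction
    refine ⟨M, fun n => ?_⟩
    have heq : (fun σ => ‖w n σ • e₀‖) = fun σ => |w n σ| := by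
      funext σ; exact norm_smul_single (w n σ)
    rw [heq]
    exact hM n
  · -- forward boundedness of the renormalised energy
    obtain ⟨σ₀, P, hP⟩ := hbdd n
    refine ⟨σ₀, P, fun σ hσ => ?_⟩
    rw [norm_smul_single, sq_abs]
    exact hP σ hσ

/-- **Scalar uniform bound ⇒ `UniformBound`** of the embedded solution. [cite: Tao2016AveragedNS, §6.4; cell vocabulary (`UniformBound`)] -/
theorem uniformBound_of_scalar {C : ℝ} (hC : ∀ (n : ℤ) (σ : ℝ), |w n σ| ≤ C) :
    UniformBound (fun n σ => w n σ • EuclideanSpace.single (0 : Fin 4) (1 : ℝ)) := by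
  have norm_smul_single : ∀ c : ℝ, ‖(c • EuclideanSpace.single (0 : Fin 4) (1 : ℝ) : Em 4)‖ = |c| :=
    fun c => by rw [norm_smul, PiLp.norm_single, norm_one, mul_one, Real.norm_eq_abs]
  exact ⟨C, fun n σ => by rw [norm_smul_single]; exact hC n σ⟩

end Scalar

/-! ## The scalar kill criterion -/

/-- **SCALAR KILL CRITERION FOR `TailRatchet` (door D4′ endgame).**  Suppose that at arbitrarily small scale
parameters `ε₀` there is a scalar family `w : ℤ → ℝ → ℝ` solving the renormalised dyadic lattice
`wₙ' = −wₙ + Λwₙ₋₁² − Λ⁻¹wₙwₙ₊₁` (`Λ = bigLam ε₀`) at every shell and log-time, admissible (uniform per-shell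
action bound, per-shell forward boundedness of `e^{2σ}wₙ²`), uniformly bounded (`|wₙ| ≤ C`), and PERSISTENTLY
FIRING: some level `c > 0` is reached by infinitely many forward shells `n₀ + j` at log-times `≥ σ₀`.  Then
`TailRatchet` fails (through `WakeRatchetStall.tailRatchet_false_of_persistentFiring` on the dyadic member
`dyadicTable ∈ E₂(2)` with `ν̂ = 0`).
[cite: Tao2016AveragedNS, §1.2, §4 Lemma 4.1 (4.8), §6.4; cell vocabulary] -/
theorem tailRatchet_false_of_scalarPersistentFiring
    (hF : ∀ ε : ℝ, 0 < ε → ∃ ε₀ : ℝ, 0 < ε₀ ∧ ε₀ ≤ ε ∧ ∃ w : ℤ → ℝ → ℝ,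
      (∀ (n : ℤ) (σ : ℝ), HasDerivAt (w n)
        (-(w n σ) + bigLam ε₀ * w (n - 1) σ ^ 2 - (bigLam ε₀)⁻¹ * w n σ * w (n + 1) σ) σ) ∧
      (∃ M : ℝ, ∀ n : ℤ, Integrable (fun σ => |w n σ|) ∧ ∫ σ, |w n σ| ≤ M) ∧
      (∀ n : ℤ, ∃ σ₀ P : ℝ, ∀ σ, σ₀ ≤ σ → Real.exp (2 * σ) * w n σ ^ 2 ≤ P) ∧
      (∃ C : ℝ, ∀ (n : ℤ) (σ : ℝ), |w n σ| ≤ C) ∧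
      ∃ c : ℝ, 0 < c ∧ ∃ (n₀ : ℤ) (σ₀ : ℝ),
        ∀ K : ℕ, ∃ j : ℕ, K ≤ j ∧ ∃ σ : ℝ, σ₀ ≤ σ ∧ c ≤ |w (n₀ + j) σ|) :
    ¬ TailRatchet := by
  have norm_smul_single : ∀ c : ℝ, ‖(c • EuclideanSpace.single (0 : Fin 4) (1 : ℝ) : Em 4)‖ = |c| :=
    fun c => by rw [norm_smul, PiLp.norm_single, norm_one, mul_one, Real.norm_eq_abs]
  refine WakeRatchetStall.tailRatchet_false_of_persistentFiring (R := 2) (by norm_num) fun ε hε => ?_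
  obtain ⟨ε₀, hε₀, hle, w, hlaw, haction, hbdd, ⟨C, hC⟩, c, hc, n₀, σ₀, hfire⟩ := hF ε hε
  refine ⟨ε₀, hε₀, hle, dyadicTable, inTableClass_dyadicTable le_rfl, 0, _,
    (isEternal_dyadic_of_scalar hlaw haction hbdd).isEternalVisc, uniformBound_of_scalar hC,
    c, hc, n₀, σ₀, fun K => ?_⟩
  obtain ⟨j, hj, σ, hσ, hge⟩ := hfire K
  exact ⟨j, hj, σ, hσ, by rw [norm_smul_single]; exact hge⟩

end WakeRatchetDyadicScalarEternal

end Summit.NavierStokesRegularity.NavierStokesRegularity.Theorems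

end
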